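import Mathlib
import HarnessLib
import Summits.ValiantsHypothesis.ValiantsHypothesis.Theorems.KPlusLogSqLawWeakLiftingTowerGraftWronskianDevelopable
import Summits.ValiantsHypothesis.ValiantsHypothesis.Theorems.LacunarySymmetroidMatrixDescartesCensusTwoRowBoxLeafPattern
import Summits.ValiantsHypothesis.ValiantsHypothesis.Theorems.LacunarySymmetroidMatrixDescartesCensusTNCUnifKit

/-!
# Tower graft line — CONJECTURE W AT `K = 4`: THE OPEN CELL IS THE FULLY ALTERNATING PLÜCKER PATTERN (normal form for an attack)

Helper file for LINE (B) `Cruxes/WeakLifting/Lines/tower_graft.lean` (crux `WeakLifting` = stmt-ValiantsHypothesis-19561), on hand g9's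
CONJECTURE W «`Z₊(W(u,v)) ≤ 2K − 4`» (= the `k = 1` developable conjecture of [cite: SedykhShapiro2005] on lacunary moment arcs; `K = 4` is
their Theorem A for CLOSED convex curves).  NO stub is claimed; the statement below is Descartes bookkeeping that fixes WHERE a fifth
positive zero could live.

For `K = 4`, support `d₀ < d₁ < d₂ < d₃`, Plücker coordinates `p_{ab} = uₐv_b − u_b vₐ`:
`X·W(u,v) = p₀₁(d₁−d₀)X^{d₀+d₁} + p₀₂(d₂−d₀)X^{d₀+d₂} + p₀₃(d₃−d₀)X^{d₀+d₃} + p₁₂(d₂−d₁)X^{d₁+d₂} + p₁₃(d₃−d₁)X^{d₁+d₃} + p₂₃(d₃−d₂)X^{d₂+d₃}`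
(`X_mul_wronskian_four_eq`), and `p₀₁p₂₃ − p₀₂p₁₃ + p₀₃p₁₂ = 0` (the tree's `Literature.Geometry.Riemannian.SkewFour.pfaffian_wedge_eq_zero`).  On the orientation `d₀ + d₃ < d₁ + d₂`
(e.g. every 2-tower) the exponents are sorted as written, and:

* ★ `card_posRoots_wronskian_four_le_four_of_consecutive_nonneg` — if SOME consecutive pair of the six coefficients (in that order) has
  product `≥ 0`, then `Z₊(W(u,v)) ≤ 4 = 2K − 4` (Descartes against a weak sign pattern with `≤ 4` changes, tree lemma
  `Census.signVariations_rsum_le_changes` + Mathlib `roots_countP_pos_le_signVariations`).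
* ★ `plucker_alternating_of_five_le` — hence `5 ≤ Z₊(W(u,v))` forces the FULLY ALTERNATING Plücker pattern
  `p₀₁p₀₂ < 0, p₀₂p₀₃ < 0, p₀₃p₁₂ < 0, p₁₂p₁₃ < 0, p₁₃p₂₃ < 0`, and then (`plucker_middle_dominates`) the Plücker relation reads
  `p₀₂p₁₃ = p₀₁p₂₃ + p₀₃p₁₂` with all three products NEGATIVE: the middle product dominates, `|p₀₂p₁₃| = |p₀₁p₂₃| + |p₀₃p₁₂|`.
  (The other orientation `d₁ + d₂ < d₀ + d₃` is the mirror image under support reflection; the balanced case `d₀+d₃ = d₁+d₂` is `≤ 4`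
  outright, `…WronskianDevelopable.card_posRoots_wronskian_le_four_of_balanced`.)

So a counterexample to Conjecture W at `K = 4` on a 2-tower must be a point of the big cell of `Gr(2,4)` with this sign pattern and this
magnitude relation — the normal form from which «Theorem A for arcs» (or a direct argument) has to exclude the fifth zero; the kernel holds
`4 ≤ Z₊ ≤ 5` there (`…WronskianTowerWitness`).  HONEST FRAMING: nothing on S4/S4b/S4d/S4f/S5/S5ᴸ, TowerB, `WeakLifting`, Conjecture B,
`MatrixDescartes` (18050), `VP ≠ VNP`.  Def-free.  Seat: prover leafhand-val-kpluslogsqlaw-1 g10, `--supports stmt-ValiantsHypothesis-19561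
--as helper`.  [folklore: Descartes' rule of signs (Mathlib), Plücker relation; the normal form is this work]
-/

-- `Summit.ValiantsHypothesis.ValiantsHypothesis.…` repeats a component by the D-0017 layout
-- (single-conjunct summit), which the `dupNamespace` linter flags; the name is mandated.
set_option linter.dupNamespace false
set_option autoImplicit false

namespace Summit.ValiantsHypothesis.ValiantsHypothesis.Theorems.KPlusLogSqLaw.TowerGraft

open Polynomial Finset
open scoped BigOperators Polynomial
open Summit.ValiantsHypothesis.ValiantsHypothesis.Theorems.LacunarySymmetroidMatrixDescartes.Census
  (signVariations_rsum_le_changes mul_pos_of_mul_neg_of_mul_neg mul_neg_of_mul_pos_of_mul_neg)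

namespace WronskianDevelopable

/-- **`K = 4` Plücker form of `X·W(u,v)`** (six monomials on the pair sums). [this work] -/
theorem X_mul_wronskian_four_eq (u v : Fin 4 → ℝ) (d : Fin 4 → ℕ) :
    (X : ℝ[X]) * wronskian (∑ l, C (u l) * X ^ d l) (∑ l, C (v l) * X ^ d l) =
      C ((u 0 * v 1 - u 1 * v 0) * ((d 1 : ℝ) - d 0)) * X ^ (d 0 + d 1) +
      C ((u 0 * v 2 - u 2 * v 0) * ((d 2 : ℝ) - d 0)) * X ^ (d 0 + d 2) +
      C ((u 0 * v 3 - u 3 * v 0) * ((d 3 : ℝ) - d 0)) * X ^ (d 0 + d 3) +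
      C ((u 1 * v 2 - u 2 * v 1) * ((d 2 : ℝ) - d 1)) * X ^ (d 1 + d 2) +
      C ((u 1 * v 3 - u 3 * v 1) * ((d 3 : ℝ) - d 1)) * X ^ (d 1 + d 3) +
      C ((u 2 * v 3 - u 3 * v 2) * ((d 3 : ℝ) - d 2)) * X ^ (d 2 + d 3) := by
  rw [InflectionLaw.X_mul_wronskian_fewnomial_eq]
  simp only [Fin.sum_univ_four, map_mul, map_sub, map_natCast]
  have h10 : (X : ℝ[X]) ^ (d 1 + d 0) = X ^ (d 0 + d 1) := by rw [add_comm]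
  have h20 : (X : ℝ[X]) ^ (d 2 + d 0) = X ^ (d 0 + d 2) := by rw [add_comm]
  have h30 : (X : ℝ[X]) ^ (d 3 + d 0) = X ^ (d 0 + d 3) := by rw [add_comm]
  have h21 : (X : ℝ[X]) ^ (d 2 + d 1) = X ^ (d 1 + d 2) := by rw [add_comm]
  have h31 : (X : ℝ[X]) ^ (d 3 + d 1) = X ^ (d 1 + d 3) := by rw [add_comm]
  have h32 : (X : ℝ[X]) ^ (d 3 + d 2) = X ^ (d 2 + d 3) := by rw [add_comm]
  rw [h10, h20, h30, h21, h31, h32]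
  ring

/-- the same as a `range 6` sum against the sorted exponent sequence (orientation `d₀ + d₃ < d₁ + d₂`). [this work] -/
theorem X_mul_wronskian_four_eq_rsum (u v : Fin 4 → ℝ) (d : Fin 4 → ℕ) (e : ℕ → ℕ)
    (he0 : e 0 = d 0 + d 1) (he1 : e 1 = d 0 + d 2) (he2 : e 2 = d 0 + d 3) (he3 : e 3 = d 1 + d 2) (he4 : e 4 = d 1 + d 3)
    (he5 : e 5 = d 2 + d 3) :
    (X : ℝ[X]) * wronskian (∑ l, C (u l) * X ^ d l) (∑ l, C (v l) * X ^ d l) =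
      ∑ t ∈ range 6, C ((fun t : ℕ => if t = 0 then (u 0 * v 1 - u 1 * v 0) * ((d 1 : ℝ) - d 0)
        else if t = 1 then (u 0 * v 2 - u 2 * v 0) * ((d 2 : ℝ) - d 0)
        else if t = 2 then (u 0 * v 3 - u 3 * v 0) * ((d 3 : ℝ) - d 0) else if t = 3 then (u 1 * v 2 - u 2 * v 1) * ((d 2 : ℝ) - d 1)
        else if t = 4 then (u 1 * v 3 - u 3 * v 1) * ((d 3 : ℝ) - d 1) else if t = 5 then (u 2 * v 3 - u 3 * v 2) * ((d 3 : ℝ) - d 2)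
        else 0) t) * X ^ (e t) := by
  rw [X_mul_wronskian_four_eq]
  simp only [Finset.sum_range_succ, Finset.sum_range_zero, zero_add]
  simp only [he0, he1, he2, he3, he4, he5]
  norm_num

/-- a strictly increasing extension to `ℕ` of the sorted pair sums (orientation `d₀ + d₃ < d₁ + d₂`). [this work] -/
theorem exists_strictMono_pairSums (d : Fin 4 → ℕ) (hd : StrictMono d) (hA : d 0 + d 3 < d 1 + d 2) :
    ∃ e : ℕ → ℕ, StrictMono e ∧ e 0 = d 0 + d 1 ∧ e 1 = d 0 + d 2 ∧ e 2 = d 0 + d 3 ∧ e 3 = d 1 + d 2 ∧ e 4 = d 1 + d 3 ∧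
      e 5 = d 2 + d 3 := by
  have h01 : d 0 < d 1 := hd (by decide)
  have h12 : d 1 < d 2 := hd (by decide)
  have h23 : d 2 < d 3 := hd (by decide)
  refine ⟨fun t => if t = 0 then d 0 + d 1 else if t = 1 then d 0 + d 2 else if t = 2 then d 0 + d 3 else if t = 3 then d 1 + d 2
    else if t = 4 then d 1 + d 3 else if t = 5 then d 2 + d 3 else d 2 + d 3 + t, ?_, by simp, by simp, by simp, by simp, by simp, by simp⟩
  refine strictMono_nat_of_lt_succ fun t => ?_
  rcases Nat.lt_or_ge t 6 with ht | ht
  · interval_cases t <;> simp <;> omega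
  · have h1 : t ≠ 0 := by omega
    have h2 : t ≠ 1 := by omega
    have h3 : t ≠ 2 := by omega
    have h4 : t ≠ 3 := by omega
    have h5 : t ≠ 4 := by omega
    have h5' : t ≠ 5 := by omega
    have h6 : t + 1 ≠ 0 := by omega
    have h7 : t + 1 ≠ 1 := by omega
    have h8 : t + 1 ≠ 2 := by omega
    have h9 : t + 1 ≠ 3 := by omega
    have h10 : t + 1 ≠ 4 := by omega
    have h11 : t + 1 ≠ 5 := by omega
    simp only [h1, h2, h3, h4, h5, h5', h6, h7, h8, h9, h10, h11, if_false]
    omega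

/-- ★ **`K = 4`, orientation `d₀ + d₃ < d₁ + d₂`: a consecutive pair of sorted pair-sum coefficients with product `≥ 0` gives `Z₊ ≤ 4`.**
[this work] -/
theorem card_posRoots_wronskian_four_le_four_of_consecutive_nonneg (u v : Fin 4 → ℝ) (d : Fin 4 → ℕ) (hd : StrictMono d)
    (hA : d 0 + d 3 < d 1 + d 2) (t₀ : ℕ) (ht₀ : t₀ < 5)
    (hnn : 0 ≤ (fun t : ℕ => if t = 0 then (u 0 * v 1 - u 1 * v 0) * ((d 1 : ℝ) - d 0)
        else if t = 1 then (u 0 * v 2 - u 2 * v 0) * ((d 2 : ℝ) - d 0)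
        else if t = 2 then (u 0 * v 3 - u 3 * v 0) * ((d 3 : ℝ) - d 0) else if t = 3 then (u 1 * v 2 - u 2 * v 1) * ((d 2 : ℝ) - d 1)
        else if t = 4 then (u 1 * v 3 - u 3 * v 1) * ((d 3 : ℝ) - d 1) else if t = 5 then (u 2 * v 3 - u 3 * v 2) * ((d 3 : ℝ) - d 2)
        else 0) t₀ *
      (fun t : ℕ => if t = 0 then (u 0 * v 1 - u 1 * v 0) * ((d 1 : ℝ) - d 0)
        else if t = 1 then (u 0 * v 2 - u 2 * v 0) * ((d 2 : ℝ) - d 0)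
        else if t = 2 then (u 0 * v 3 - u 3 * v 0) * ((d 3 : ℝ) - d 0) else if t = 3 then (u 1 * v 2 - u 2 * v 1) * ((d 2 : ℝ) - d 1)
        else if t = 4 then (u 1 * v 3 - u 3 * v 1) * ((d 3 : ℝ) - d 1) else if t = 5 then (u 2 * v 3 - u 3 * v 2) * ((d 3 : ℝ) - d 2)
        else 0) (t₀ + 1)) :
    ((wronskian (∑ l, C (u l) * X ^ d l) (∑ l, C (v l) * X ^ d l)).roots.toFinset.filter (fun x => 0 < x)).card ≤ 4 := by
  set c : ℕ → ℝ := fun t : ℕ => if t = 0 then (u 0 * v 1 - u 1 * v 0) * ((d 1 : ℝ) - d 0)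
        else if t = 1 then (u 0 * v 2 - u 2 * v 0) * ((d 2 : ℝ) - d 0)
        else if t = 2 then (u 0 * v 3 - u 3 * v 0) * ((d 3 : ℝ) - d 0) else if t = 3 then (u 1 * v 2 - u 2 * v 1) * ((d 2 : ℝ) - d 1)
        else if t = 4 then (u 1 * v 3 - u 3 * v 1) * ((d 3 : ℝ) - d 1) else if t = 5 then (u 2 * v 3 - u 3 * v 2) * ((d 3 : ℝ) - d 2)
        else 0 with hc
  obtain ⟨e, he, he0, he1, he2, he3, he4, he5⟩ := exists_strictMono_pairSums d hd hA
  have hXW := X_mul_wronskian_four_eq_rsum u v d e he0 he1 he2 he3 he4 he5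
  rw [← InflectionLaw.card_posRoots_X_mul, hXW]
  -- distinct positive roots ≤ positive roots with multiplicity ≤ sign variations ≤ changes of a weak pattern
  set N : ℝ[X] := ∑ t ∈ range 6, C (c t) * X ^ (e t) with hN
  have h1 : (N.roots.toFinset.filter (fun x => 0 < x)).card ≤ N.roots.countP (fun x => 0 < x) := by
    calc (N.roots.toFinset.filter (fun x => 0 < x)).card
        = (N.roots.filter (fun x => 0 < x)).toFinset.card := by rw [Multiset.toFinset_filter]
      _ ≤ Multiset.card (N.roots.filter (fun x => 0 < x)) := Multiset.toFinset_card_le _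
      _ = N.roots.countP (fun x => 0 < x) := (Multiset.countP_eq_card_filter _ _).symm
  have h2 : N.roots.countP (fun x => 0 < x) ≤ N.signVariations := N.roots_countP_pos_le_signVariations
  -- the weak pattern: the sign of `c`, made constant on the pair `t₀, t₀+1`
  rcases le_or_gt 0 (c t₀) with hct | hct
  · -- case `c t₀ ≥ 0`: then `c (t₀+1) ≥ 0` too (product ≥ 0 and, if `c t₀ = 0`, choose pattern by `c (t₀+1)`)
    rcases lt_or_ge (c (t₀ + 1)) 0 with hcs | hcs
    · -- then `c t₀ = 0`; use the pattern `0 < c` (both positions `false`)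
      have hct0 : c t₀ = 0 := by
        by_contra hne
        have : 0 < c t₀ := lt_of_le_of_ne hct (Ne.symm hne)
        have := mul_neg_of_pos_of_neg this hcs
        linarith
      have h3 := signVariations_rsum_le_changes 6 e he c (fun t => decide (0 < c t))
        (fun t _ ht => le_of_lt (of_decide_eq_true ht)) (fun t _ ht => by simpa using ht)
      have h4 : (∑ t ∈ range (6 - 1), if (fun t => decide (0 < c t)) t = (fun t => decide (0 < c t)) (t + 1) then 0 else 1) ≤ 4 := by
        have hsame : decide (0 < c t₀) = decide (0 < c (t₀ + 1)) := by
          rw [hct0]; simp [not_lt.mpr hcs.le]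
        have hsplit := Finset.add_sum_erase (range 5) (fun t => if decide (0 < c t) = decide (0 < c (t + 1)) then 0 else 1)
          (Finset.mem_range.mpr ht₀)
        simp only [hsame, if_true, zero_add] at hsplit
        have hrest : (∑ t ∈ (range 5).erase t₀, if decide (0 < c t) = decide (0 < c (t + 1)) then 0 else 1) ≤ ((range 5).erase t₀).card :=
          Finset.sum_le_card_nsmul _ _ 1 (fun t _ => by split_ifs <;> simp) |>.trans (by simp)
        rw [Finset.card_erase_of_mem (Finset.mem_range.mpr ht₀), Finset.card_range] at hrest
        show (∑ t ∈ range 5, if decide (0 < c t) = decide (0 < c (t + 1)) then 0 else 1) ≤ 4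
        rw [← hsplit]; exact hrest
      exact h1.trans (h2.trans (h3.trans h4))
    · have h3 := signVariations_rsum_le_changes 6 e he c (fun t => decide (0 ≤ c t))
        (fun t _ ht => of_decide_eq_true ht) (fun t _ ht => by simpa using (le_of_lt (by simpa using ht)))
      have h4 : (∑ t ∈ range (6 - 1), if (fun t => decide (0 ≤ c t)) t = (fun t => decide (0 ≤ c t)) (t + 1) then 0 else 1) ≤ 4 := by
        have hsame : decide (0 ≤ c t₀) = decide (0 ≤ c (t₀ + 1)) := by simp [hct, hcs]
        have hsplit := Finset.add_sum_erase (range 5) (fun t => if decide (0 ≤ c t) = decide (0 ≤ c (t + 1)) then 0 else 1)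
          (Finset.mem_range.mpr ht₀)
        simp only [hsame, if_true, zero_add] at hsplit
        have hrest : (∑ t ∈ (range 5).erase t₀, if decide (0 ≤ c t) = decide (0 ≤ c (t + 1)) then 0 else 1) ≤ ((range 5).erase t₀).card :=
          Finset.sum_le_card_nsmul _ _ 1 (fun t _ => by split_ifs <;> simp) |>.trans (by simp)
        rw [Finset.card_erase_of_mem (Finset.mem_range.mpr ht₀), Finset.card_range] at hrest
        show (∑ t ∈ range 5, if decide (0 ≤ c t) = decide (0 ≤ c (t + 1)) then 0 else 1) ≤ 4
        rw [← hsplit]; exact hrest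
      exact h1.trans (h2.trans (h3.trans h4))
  · -- case `c t₀ < 0`: then `c (t₀+1) ≤ 0`; use the pattern `0 < c` (both positions `false`)
    have hcs : c (t₀ + 1) ≤ 0 := by
      by_contra hpos
      have hpos' : 0 < c (t₀ + 1) := not_le.mp hpos
      have := mul_neg_of_neg_of_pos hct hpos'
      linarith
    have h3 := signVariations_rsum_le_changes 6 e he c (fun t => decide (0 < c t))
      (fun t _ ht => le_of_lt (of_decide_eq_true ht)) (fun t _ ht => by simpa using ht)
    have h4 : (∑ t ∈ range (6 - 1), if (fun t => decide (0 < c t)) t = (fun t => decide (0 < c t)) (t + 1) then 0 else 1) ≤ 4 := by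
      have hsame : decide (0 < c t₀) = decide (0 < c (t₀ + 1)) := by simp [not_lt.mpr hct.le, not_lt.mpr hcs]
      have hsplit := Finset.add_sum_erase (range 5) (fun t => if decide (0 < c t) = decide (0 < c (t + 1)) then 0 else 1)
        (Finset.mem_range.mpr ht₀)
      simp only [hsame, if_true, zero_add] at hsplit
      have hrest : (∑ t ∈ (range 5).erase t₀, if decide (0 < c t) = decide (0 < c (t + 1)) then 0 else 1) ≤ ((range 5).erase t₀).card :=
        Finset.sum_le_card_nsmul _ _ 1 (fun t _ => by split_ifs <;> simp) |>.trans (by simp)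
      rw [Finset.card_erase_of_mem (Finset.mem_range.mpr ht₀), Finset.card_range] at hrest
      show (∑ t ∈ range 5, if decide (0 < c t) = decide (0 < c (t + 1)) then 0 else 1) ≤ 4
      rw [← hsplit]; exact hrest
    exact h1.trans (h2.trans (h3.trans h4))

/-- ★ **THE MIDDLE PRODUCT DOMINATES.**  Pure algebra of the open cell: the fully alternating pattern (consecutive products negative in
the order `01, 02, 03, 12, 13, 23`) together with the Plücker relation forces `p₀₁p₂₃ < 0`, `p₀₃p₁₂ < 0`, `p₀₂p₁₃ < 0` and
`p₀₂p₁₃ = p₀₁p₂₃ + p₀₃p₁₂`, i.e. `|p₀₂p₁₃| = |p₀₁p₂₃| + |p₀₃p₁₂|`. [this work] -/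
theorem plucker_middle_dominates {p01 p02 p03 p12 p13 p23 : ℝ} (h1 : p01 * p02 < 0) (h2 : p02 * p03 < 0) (h3 : p03 * p12 < 0)
    (h4 : p12 * p13 < 0) (h5 : p13 * p23 < 0) (hrel : p01 * p23 - p02 * p13 + p03 * p12 = 0) :
    p01 * p23 < 0 ∧ p03 * p12 < 0 ∧ p02 * p13 < 0 ∧ p02 * p13 = p01 * p23 + p03 * p12 := by
  have h13 : 0 < p01 * p03 := mul_pos_of_mul_neg_of_mul_neg h1 h2
  have h1_12 : p01 * p12 < 0 := mul_neg_of_mul_pos_of_mul_neg h13 h3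
  have h1_13 : 0 < p01 * p13 := mul_pos_of_mul_neg_of_mul_neg h1_12 h4
  have h1_23 : p01 * p23 < 0 := mul_neg_of_mul_pos_of_mul_neg h1_13 h5
  have h2_13 : p02 * p13 < 0 := by
    have h' : 0 < p13 * p01 := by rw [mul_comm]; exact h1_13
    have h'' : p13 * p02 < 0 := mul_neg_of_mul_pos_of_mul_neg h' h1
    rw [mul_comm] at h''; exact h''
  refine ⟨h1_23, h3, h2_13, by linarith⟩

/-- ★ **`K = 4`, orientation `d₀ + d₃ < d₁ + d₂`: five positive zeros force the fully alternating Plücker pattern** (and hence, with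
`SkewFour.pfaffian_wedge_eq_zero` and `plucker_middle_dominates`, the domination of the middle product). [this work] -/
theorem plucker_alternating_of_five_le (u v : Fin 4 → ℝ) (d : Fin 4 → ℕ) (hd : StrictMono d) (hA : d 0 + d 3 < d 1 + d 2)
    (h5 : 5 ≤ ((wronskian (∑ l, C (u l) * X ^ d l) (∑ l, C (v l) * X ^ d l)).roots.toFinset.filter (fun x => 0 < x)).card) :
    (u 0 * v 1 - u 1 * v 0) * (u 0 * v 2 - u 2 * v 0) < 0 ∧ (u 0 * v 2 - u 2 * v 0) * (u 0 * v 3 - u 3 * v 0) < 0 ∧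
      (u 0 * v 3 - u 3 * v 0) * (u 1 * v 2 - u 2 * v 1) < 0 ∧ (u 1 * v 2 - u 2 * v 1) * (u 1 * v 3 - u 3 * v 1) < 0 ∧
      (u 1 * v 3 - u 3 * v 1) * (u 2 * v 3 - u 3 * v 2) < 0 := by
  have h01 : (d 0 : ℝ) < d 1 := by exact_mod_cast hd (show (0 : Fin 4) < 1 by decide)
  have h02 : (d 0 : ℝ) < d 2 := by exact_mod_cast hd (show (0 : Fin 4) < 2 by decide)
  have h03 : (d 0 : ℝ) < d 3 := by exact_mod_cast hd (show (0 : Fin 4) < 3 by decide)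
  have h12 : (d 1 : ℝ) < d 2 := by exact_mod_cast hd (show (1 : Fin 4) < 2 by decide)
  have h13 : (d 1 : ℝ) < d 3 := by exact_mod_cast hd (show (1 : Fin 4) < 3 by decide)
  have h23 : (d 2 : ℝ) < d 3 := by exact_mod_cast hd (show (2 : Fin 4) < 3 by decide)
  -- each consecutive product of the sorted coefficients is negative, else `Z₊ ≤ 4`
  have hc : ∀ t, t < 5 → (fun t : ℕ => if t = 0 then (u 0 * v 1 - u 1 * v 0) * ((d 1 : ℝ) - d 0)
        else if t = 1 then (u 0 * v 2 - u 2 * v 0) * ((d 2 : ℝ) - d 0)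
        else if t = 2 then (u 0 * v 3 - u 3 * v 0) * ((d 3 : ℝ) - d 0) else if t = 3 then (u 1 * v 2 - u 2 * v 1) * ((d 2 : ℝ) - d 1)
        else if t = 4 then (u 1 * v 3 - u 3 * v 1) * ((d 3 : ℝ) - d 1) else if t = 5 then (u 2 * v 3 - u 3 * v 2) * ((d 3 : ℝ) - d 2)
        else 0) t *
      (fun t : ℕ => if t = 0 then (u 0 * v 1 - u 1 * v 0) * ((d 1 : ℝ) - d 0)
        else if t = 1 then (u 0 * v 2 - u 2 * v 0) * ((d 2 : ℝ) - d 0)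
        else if t = 2 then (u 0 * v 3 - u 3 * v 0) * ((d 3 : ℝ) - d 0) else if t = 3 then (u 1 * v 2 - u 2 * v 1) * ((d 2 : ℝ) - d 1)
        else if t = 4 then (u 1 * v 3 - u 3 * v 1) * ((d 3 : ℝ) - d 1) else if t = 5 then (u 2 * v 3 - u 3 * v 2) * ((d 3 : ℝ) - d 2)
        else 0) (t + 1) < 0 := by
    intro t ht
    by_contra hnn
    have h4 := card_posRoots_wronskian_four_le_four_of_consecutive_nonneg u v d hd hA t ht (not_lt.mp hnn)
    omega
  -- remove the positive exponent-difference factors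
  have strip : ∀ {p q a b : ℝ}, 0 < a → 0 < b → (p * a) * (q * b) < 0 → p * q < 0 := by
    intro p q a b ha hb h
    have hab : 0 < a * b := mul_pos ha hb
    have key : (p * a) * (q * b) = (p * q) * (a * b) := by ring
    rw [key] at h
    by_contra hpq
    have : 0 ≤ p * q * (a * b) := mul_nonneg (not_lt.mp hpq) hab.le
    linarith
  have c0 := hc 0 (by norm_num); have c1 := hc 1 (by norm_num); have c2 := hc 2 (by norm_num)
  have c3 := hc 3 (by norm_num); have c4 := hc 4 (by norm_num)
  simp only [if_true, show (0:ℕ) + 1 = 1 from rfl, show (1:ℕ) + 1 = 2 from rfl, show (2:ℕ) + 1 = 3 from rfl,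
    show (3:ℕ) + 1 = 4 from rfl, show (4:ℕ) + 1 = 5 from rfl] at c0 c1 c2 c3 c4
  norm_num at c0 c1 c2 c3 c4
  exact ⟨strip (sub_pos.mpr h01) (sub_pos.mpr h02) c0, strip (sub_pos.mpr h02) (sub_pos.mpr h03) c1,
    strip (sub_pos.mpr h03) (sub_pos.mpr h12) c2, strip (sub_pos.mpr h12) (sub_pos.mpr h13) c3,
    strip (sub_pos.mpr h13) (sub_pos.mpr h23) c4⟩

/-- ★ **normal form of a would-be counterexample at `K = 4`** (orientation `d₀ + d₃ < d₁ + d₂`): five positive zeros force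
`p₀₁p₂₃ < 0`, `p₀₃p₁₂ < 0`, `p₀₂p₁₃ < 0` and `p₀₂p₁₃ = p₀₁p₂₃ + p₀₃p₁₂` (Plücker relation, `ring`; = the tree's
`Literature.Geometry.Riemannian.SkewFour.pfaffian_wedge_eq_zero`). [this work] -/
theorem plucker_normal_form_of_five_le (u v : Fin 4 → ℝ) (d : Fin 4 → ℕ) (hd : StrictMono d) (hA : d 0 + d 3 < d 1 + d 2)
    (h5 : 5 ≤ ((wronskian (∑ l, C (u l) * X ^ d l) (∑ l, C (v l) * X ^ d l)).roots.toFinset.filter (fun x => 0 < x)).card) :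
    (u 0 * v 1 - u 1 * v 0) * (u 2 * v 3 - u 3 * v 2) < 0 ∧ (u 0 * v 3 - u 3 * v 0) * (u 1 * v 2 - u 2 * v 1) < 0 ∧
      (u 0 * v 2 - u 2 * v 0) * (u 1 * v 3 - u 3 * v 1) < 0 ∧
      (u 0 * v 2 - u 2 * v 0) * (u 1 * v 3 - u 3 * v 1) =
        (u 0 * v 1 - u 1 * v 0) * (u 2 * v 3 - u 3 * v 2) + (u 0 * v 3 - u 3 * v 0) * (u 1 * v 2 - u 2 * v 1) := by
  obtain ⟨h1, h2, h3, h4, h5'⟩ := plucker_alternating_of_five_le u v d hd hA h5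
  -- the Plücker relation of `Gr(2,4)` (also the tree's `Literature.Geometry.Riemannian.SkewFour.pfaffian_wedge_eq_zero`)
  have hrel : (u 0 * v 1 - u 1 * v 0) * (u 2 * v 3 - u 3 * v 2) - (u 0 * v 2 - u 2 * v 0) * (u 1 * v 3 - u 3 * v 1) +
      (u 0 * v 3 - u 3 * v 0) * (u 1 * v 2 - u 2 * v 1) = 0 := by ring
  exact plucker_middle_dominates h1 h2 h3 h4 h5' hrel

end WronskianDevelopable

end Summit.ValiantsHypothesis.ValiantsHypothesis.Theorems.KPlusLogSqLaw.TowerGraft
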